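import Literature.AnabelianGeometry.AbsoluteAnabelian.AbsTopII.EllipticCuspidalizationContent

/-!
# [AbsTopII] Cor 3.3 (iii)(a) content conjunct: consequences (PROOF-ONLY)

S. Mochizuki, *Topics in Absolute Anabelian Geometry II* [AbsTopII] (bib `MochizukiAbsTopII2013`,
kurims manuscript `paper:url-585b8d0ad0d9`), §3 Cor 3.3 (iii)(a) p. 68.

No definition.  PROVED: `EllipticCuspidalization.RealizesChain.hasProSigmaTerminalChainOfType` (the
content conjunct refines the recorded chain clause `HasProSigmaTerminalChainOfType … K.typeChain K.PiV`
of `EllipticCuspidalizationComparison.lean`, p409138) and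
`EllipticCuspidalization.RealizesChain.projU_injective_of_sq_sub_one_eq_zero` (an EMPTY •-block —
`N² − 1 = 0` — forces the output's `Π_U ↠ Π_D` to be injective: the conjunct bites on outputs that
actually remove torsion points).  abc-iut-L4-t6 lineage; typed ≠ proved; nothing here bears on
[IUTchIII] Cor 3.12.
-/

open CategoryTheory Topology

universe u

namespace Literature.AnabelianGeometry.AbsoluteAnabelian.AbsTopII

open Literature.AlgebraicGeometry.Frobenioids (IsSlimGroup)
open FundamentalExtension

namespace EllipticCuspidalization

variable {E : FundamentalExtension.{u}} {K : EllipticCuspidalization E} {S : Set ℕ}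
  {CD : CuspidalData E} {hP : IsSlimGroup E.arith} {hΔ : IsSlimGroup E.geom} {hne : E.geom ≠ ⊥}

/-- `RealizesChain` refines the recorded chain clause (same pro-`Σ` chain, same terminal isomorphism,
the second-to-last term `Π_v ≅ Π_V` over `G`). [cite: MochizukiAbsTopII2013, Cor 3.3 (iii)(a) p.68] -/
theorem RealizesChain.hasProSigmaTerminalChainOfType (h : K.RealizesChain S CD hP hΔ hne) :
    HasProSigmaTerminalChainOfType S CD hP hΔ hne K.typeChain K.PiV := by
  obtain ⟨c, hS, htype, hiso, s, t, v, -, -, hv, -, -, eV, -, -, gV, -, -, -, heV, -, -, -⟩ := h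
  exact ⟨c, hS, htype, hiso, v, hv, eV, gV, heV⟩

/-- **The conjunct bites**: if the •-block is EMPTY (`N² − 1 = 0`), `RealizesChain` forces the
output's `Π_U ↠ Π_D` to be injective. [cite: MochizukiAbsTopII2013, Cor 3.3 (iii)(a) p.68] -/
theorem RealizesChain.projU_injective_of_sq_sub_one_eq_zero (h : K.RealizesChain S CD hP hΔ hne)
    (h0 : K.N ^ 2 - 1 = 0) : Function.Injective K.projU.arith := by
  obtain ⟨c, -, -, -, s, t, v, hst, -, -, eU, eD, -, -, -, -, ψ, -, -, -, hψs, -, hψt⟩ := h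
  have hst' : s = t := Fin.ext (by omega)
  subst hst'
  intro x y hxy
  have hx := hψt x
  have hy := hψt y
  rw [hψs] at hx hy
  have : eD.symm (eU x) = eD.symm (eU y) := Subtype.ext (by rw [hx, hy, hxy])
  exact eU.injective (eD.symm.injective this)

end EllipticCuspidalization

end Literature.AnabelianGeometry.AbsoluteAnabelian.AbsTopII
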